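/-
Copyright: literature formalisation for the harness. Statements follow the cited text.
-/
import Literature.AlgebraicGeometry.CossartPiltant200819.SetupAssembly2008
import HarnessLib

/-!
# Cossart–Piltant I (2008), Thm 7.2 — the tame segment `K₀ⁱ → K₀ʳ`, down to total ramification

Sequel to `GaloisSegment2008` / `SetupAssembly2008`, where the tower fact behind Thm 7.2 was
reduced to the tame climb `TameSegmentClimb2008 k` (proof of Thm 7.2, HAL p. 20: "By (8), `K₀ʳ/K₀ⁱ`
is an Abelian extension of order prime to `p`, whence a tower of Abelian extensions of prime
degrees `lᵢ ≠ p`. Therefore … `W ∩ K₀ʳ/k` has a local uniformization by proposition 8.3 (2) (whose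
assumption is satisfied by (9))" — (8) being the isomorphism `Gi/Gr ≃ Hom(WjL/VK, κ(Wj)^×)` and
(9) `[L : K] = sefp^d` of HAL p. 6, and assumption (2) of Prop. 8.3 "`[L : K] = |WL/VK|`",
HAL p. 23). Here the Galois-theoretic half of that sentence is PROVED and the climb is reduced to
its valuation-theoretic half, **total ramification of the layers of `Kʳ/Kⁱ`** (the value-group
form of assumption 8.3 (2) at every layer; Zariski–Samuel VI §12 Thm 25; Cossart–Piltant 2019,
proof of Prop. 4.10: "`Fʳ|Fⁱ` is an Abelian extension of order prime to `p` which is totally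
ramified"):

* `mem_inertiaGroup_iff'` — Mathlib's inertia subgroup made concrete: `σ ∈ G_i(W/V)` iff
  `σ • W = W` and `v(σ x − x) < 1` on `W`; `autTopHom_mem_inertiaGroupIn_iff` — agreement with
  `Resolution.inertiaGroupIn` (Zariski–Samuel's `G_T`, ambient `Ω := L`);
* `ramificationGroup_le_inertiaGroup`, `commutator_mem_ramificationGroup` — `G_r ≤ G_i` and
  `G_i/G_r` abelian (transported from `Resolution.KrullRamificationGroups`);
* `exists_le_prime_index_of_commutator_mem` — group theory: a proper subgroup containing the
  commutators sits with prime index inside a larger subgroup;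
* `CReach3.climb_of_commutator_mem` — **the abelian climb**: below the fixed field of a subgroup
  `V ⊇ [G, G]` every intermediate field is reached by `primeUp` moves, GIVEN total ramification
  of the layers (`e = degree`);
* `TameLayersTotallyRamified2008` — the named residual; `tameSegmentClimb2008_of_layers` —
  **`TameSegmentClimb2008 k` for every `k`**, hence `coarseTowerExists2008_of_layers`,
  `galoisTowerExists2008_of_layers`, `reductionToArtinSchreier_of_layers`,
  `lu3DiffFinite_of_layers`.
-/

namespace Literature.AlgebraicGeometry.CossartPiltant200819.CP2008

open Literature.AlgebraicGeometry.Resolution IsLocalRing IntermediateField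
open scoped Pointwise IntermediateField

universe u

section Bridge

variable {K L : Type u} [Field K] [Field L] [Algebra K L]

/-- **`G_i(W/V)` concretely**: `σ` lies in the inertia group iff `σ` fixes `W` and acts
trivially on its residue field, i.e. `v(σ x − x) < 1` for `x ∈ W` (HAL p. 5, (3)). [folklore] -/
theorem mem_inertiaGroup_iff' (W : ValuationSubring L) (σ : L ≃ₐ[K] L) :
    σ ∈ inertiaGroup W ↔ σ • W = W ∧ ∀ x : L, x ∈ W → W.valuation (σ x - x) < 1 := by
  rw [mem_inertiaGroup_iff]
  constructor
  · rintro ⟨hσ, hin⟩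
    refine ⟨MulAction.mem_stabilizer_iff.mp hσ, fun x hx => ?_⟩
    have h1 := DFunLike.congr_fun (MonoidHom.mem_ker.mp hin) (residue W ⟨x, hx⟩)
    change (⟨σ, hσ⟩ : W.decompositionSubgroup K) • residue W ⟨x, hx⟩ = residue W ⟨x, hx⟩ at h1
    rw [← ResidueField.residue_smul, ← sub_eq_zero, ← map_sub, residue_eq_zero_iff,
      W.valuation_lt_one_iff] at h1
    exact h1
  · rintro ⟨hσ, hv⟩
    have hσ' : σ ∈ W.decompositionSubgroup K := MulAction.mem_stabilizer_iff.mpr hσ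
    refine ⟨hσ', MonoidHom.mem_ker.mpr ?_⟩
    ext r
    obtain ⟨a, rfl⟩ := Ideal.Quotient.mk_surjective r
    change (⟨σ, hσ'⟩ : W.decompositionSubgroup K) • residue W a = residue W a
    rw [← ResidueField.residue_smul, ← sub_eq_zero, ← map_sub, residue_eq_zero_iff, W.valuation_lt_one_iff]
    exact hv a a.2

/-- **Agreement with Zariski–Samuel's `G_T`** (`Resolution.inertiaGroupIn`, ambient `Ω := L`).
[cite: ZariskiSamuel1960, Ch. VI §12, p. 68] -/
theorem autTopHom_mem_inertiaGroupIn_iff (W : ValuationSubring L) (σ : L ≃ₐ[K] L) :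
    autTopHom σ ∈ inertiaGroupIn W (⊤ : IntermediateField (baseSubfield K L) L) ↔
      σ ∈ inertiaGroup W := by
  rw [mem_inertiaGroup_iff', Resolution.mem_inertiaGroupIn_iff]
  constructor
  · rintro ⟨h1, h2⟩
    refine ⟨?_, fun x hx => h2 ⟨x, mem_top⟩ hx⟩
    ext x
    rw [ValuationSubring.mem_pointwise_smul_iff_inv_smul_mem]
    have h := h1 ⟨σ⁻¹ • x, mem_top⟩
    have h' : σ (σ⁻¹ • x) = x := by
      rw [AlgEquiv.smul_def]
      exact AlgEquiv.apply_symm_apply σ x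
    change σ⁻¹ • x ∈ W ↔ σ (σ⁻¹ • x) ∈ W at h
    rw [h' ] at h
    exact h
  · rintro ⟨h1, h2⟩
    refine ⟨fun x => ?_, fun x hx => h2 x hx⟩
    change (x : L) ∈ W ↔ σ • (x : L) ∈ W
    conv_rhs => rw [← h1]
    exact ValuationSubring.smul_mem_pointwise_smul_iff.symm

/-- **`G_r ≤ G_i`** (HAL p. 6: "`G_r(W/V) := {g ∈ G_i(W/V) | …}`").
[cite: CossartPiltant2008, Section 3 (HAL p. 6)] -/
theorem ramificationGroup_le_inertiaGroup (W : ValuationSubring L) :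
    ramificationGroup (K := K) W ≤ inertiaGroup W := fun σ hσ =>
  (autTopHom_mem_inertiaGroupIn_iff W σ).mp
    (ramificationGroupIn_le_inertiaGroupIn W _ (Subgroup.mem_comap.mp hσ))

/-- `Kⁱ ⊆ Kʳ`. [cite: CossartPiltant2008, Section 3 (HAL p. 6)] -/
theorem fixedField_inertiaGroup_le (W : ValuationSubring L) :
    fixedField (inertiaGroup (K := K) W) ≤ fixedField (ramificationGroup (K := K) W) :=
  fun x hx => (mem_fixedField_iff _ x).mpr fun σ hσ =>
    (mem_fixedField_iff _ x).mp hx σ (ramificationGroup_le_inertiaGroup W hσ)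

/-- `⊤ : IntermediateField (K-range) L` is finite over the range of `K`. [folklore] -/
theorem finiteDimensional_top_baseSubfield [FiniteDimensional K L] :
    FiniteDimensional (baseSubfield K L) (⊤ : IntermediateField (baseSubfield K L) L) := by
  letI : Algebra K (baseSubfield K L) := (algebraMap K L).rangeRestrictField.toAlgebra
  haveI : IsScalarTower K (baseSubfield K L) L := IsScalarTower.of_algebraMap_eq fun x => rfl
  haveI : FiniteDimensional (baseSubfield K L) L :=
    Module.Finite.of_restrictScalars_finite K (baseSubfield K L) L
  exact LinearEquiv.finiteDimensional
    (IntermediateField.topEquiv (F := baseSubfield K L) (E := L)).symm.toLinearEquiv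

/-- **`G_i/G_r` is abelian**: commutators of the inertia group lie in the ramification group
(HAL (8): "`K₀ʳ/K₀ⁱ` is an Abelian extension"; Zariski–Samuel VI §12 Thm 25, transported from
`Resolution.commutator_mem_ramificationGroupIn`).
[cite: ZariskiSamuel1960, Ch. VI §12, Thm. 25, p. 78] -/
theorem commutator_mem_ramificationGroup [FiniteDimensional K L] (W : ValuationSubring L)
    {σ τ : L ≃ₐ[K] L} (hσ : σ ∈ inertiaGroup W) (hτ : τ ∈ inertiaGroup W) :
    σ * τ * σ⁻¹ * τ⁻¹ ∈ ramificationGroup W := by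
  haveI := finiteDimensional_top_baseSubfield (K := K) (L := L)
  refine Subgroup.mem_comap.mpr ?_
  rw [map_mul, map_mul, map_mul, map_inv, map_inv]
  exact commutator_mem_ramificationGroupIn W _ ((autTopHom_mem_inertiaGroupIn_iff W σ).mpr hσ)
    ((autTopHom_mem_inertiaGroupIn_iff W τ).mpr hτ)

end Bridge

section GroupLemma

/-- For a surjection `f : G → Q` and `x ∈ Q`, the kernel has index `ord x` in `f⁻¹⟨x⟩`.
[folklore] -/
theorem relIndex_ker_comap_zpowers {G Q : Type*} [Group G] [Group Q] (f : G →* Q)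
    (hf : Function.Surjective f) (x : Q) :
    f.ker.relIndex ((Subgroup.zpowers x).comap f) = orderOf x := by
  rw [← MonoidHom.comap_bot, Subgroup.relIndex_comap,
    Subgroup.map_comap_eq_self_of_surjective hf, Subgroup.relIndex_bot_left, Nat.card_zpowers]

/-- **Group theory**: in a finite group, a proper subgroup `H` containing all commutators lies
with PRIME index in some larger subgroup `N` (an element of prime order of `G/H`). [folklore] -/
theorem exists_le_prime_index_of_commutator_mem {G : Type*} [Group G] [Finite G]
    {H : Subgroup G} (hH : H ≠ ⊤) (hcomm : ∀ a b : G, a * b * a⁻¹ * b⁻¹ ∈ H) :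
    ∃ N : Subgroup G, H ≤ N ∧ ((H.subgroupOf N).index).Prime := by
  haveI hn : H.Normal := ⟨fun h hh g => by simpa using H.mul_mem (hcomm g h) hh⟩
  have hcard : 1 < Nat.card (G ⧸ H) := by
    have h0 : Nat.card (G ⧸ H) ≠ 0 := Nat.card_pos.ne'
    have h1 : Nat.card (G ⧸ H) ≠ 1 := by
      rw [← Subgroup.index_eq_card, Ne, Subgroup.index_eq_one]
      exact hH
    omega
  haveI : Fact (Nat.card (G ⧸ H)).minFac.Prime := ⟨Nat.minFac_prime (ne_of_gt hcard)⟩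
  obtain ⟨x, hx⟩ := exists_prime_orderOf_dvd_card' (G := G ⧸ H) (Nat.card (G ⧸ H)).minFac
    (Nat.minFac_dvd _)
  refine ⟨(Subgroup.zpowers x).comap (QuotientGroup.mk' H), fun h hh => ?_, ?_⟩
  · rw [Subgroup.mem_comap, QuotientGroup.mk'_apply, (QuotientGroup.eq_one_iff h).mpr hh]
    exact one_mem _
  · have key := relIndex_ker_comap_zpowers (QuotientGroup.mk' H) (QuotientGroup.mk'_surjective H) x
    rw [QuotientGroup.ker_mk', hx] at key
    change (H.relIndex _).Prime
    rw [key]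
    exact Fact.out

end GroupLemma

section Climb

variable {k : Type u} [Field k]

/-- **The abelian climb** (the Galois-theoretic half of HAL (8), PROVED): `L/F` finite Galois,
`V ≤ Gal(L/F)` containing all commutators, `W` a valuation ring of `L` containing `k`; if every
layer `B₁ ⊆ B` below the fixed field of `V` is totally ramified for `W` (`e = [B : B₁]`), then
the stage `(F, W ∩ F)` reaches `(B, W ∩ B)` for every `B ⊆ L^V` — along `F = B⁽⁰⁾ ⊂ ⋯ ⊂ B`,
steps of prime degree, each a `primeUp` move with `e = ℓ`.
[cite: CossartPiltant2008, Thm 7.2 proof, (8) (HAL p. 20)] -/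
theorem CReach3.climb_of_commutator_mem {F L : Type u} [Field F] [Algebra k F] [Field L]
    [Algebra F L] [Algebra k L] [IsScalarTower k F L] [FiniteDimensional F L] [IsGalois F L]
    (V : Subgroup (L ≃ₐ[F] L)) (hcomm : ∀ a b : L ≃ₐ[F] L, a * b * a⁻¹ * b⁻¹ ∈ V)
    (W : ValuationSubring L) (hkW : ∀ c : k, algebraMap k L c ∈ W)
    (horacle : ∀ (B₁ B : IntermediateField F L) (h : B₁ ≤ B), B ≤ fixedField V →
      ramificationIndex B₁ (W.comap (algebraMap (extendScalars h) L)) =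
        Module.finrank B₁ (extendScalars h))
    (B : IntermediateField F L) (hB : B ≤ fixedField V) :
    CReach3 k ⟨F, W.comap (algebraMap F L), forall_algebraMap_mem_comap hkW⟩
      ⟨B, W.comap (algebraMap B L), forall_algebraMap_mem_comap_intermediateField hkW B⟩ := by
  suffices hmain : ∀ (n : ℕ) (B : IntermediateField F L), B ≤ fixedField V →
      B.fixingSubgroup.index = n →
      CReach3 k ⟨F, W.comap (algebraMap F L), forall_algebraMap_mem_comap hkW⟩
        ⟨B, W.comap (algebraMap B L), forall_algebraMap_mem_comap_intermediateField hkW B⟩ from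
    hmain _ B hB rfl
  intro n
  induction n using Nat.strong_induction_on with
  | _ n ih =>
  intro B hB hn
  by_cases htop : B.fixingSubgroup = ⊤
  · have hB0 : B = ⊥ := by
      rw [← IsGalois.fixedField_fixingSubgroup B, htop, IsGalois.fixedField_top]
    subst hB0
    exact CReach3.toBotStage W hkW
  -- `H := Gal(L/B) ⊇ V ⊇ [G, G]`: a subgroup `N ⊇ H` with `(N : H) = ℓ` prime; `B₁ := L^N ⊆ B`
  have hVH : V ≤ B.fixingSubgroup := (IntermediateField.le_iff_le V B).mp hB
  obtain ⟨N, hHN, hℓ⟩ := exists_le_prime_index_of_commutator_mem htop fun a b => hVH (hcomm a b)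
  set ℓ := (B.fixingSubgroup.subgroupOf N).index with hℓdef
  set B₁ : IntermediateField F L := fixedField N with hB₁
  have hNB₁ : B₁.fixingSubgroup = N := fixingSubgroup_fixedField N
  have hle : B₁ ≤ B := fun x hx => by
    have hx' : x ∈ fixedField B.fixingSubgroup :=
      (mem_fixedField_iff _ x).mpr fun σ hσ => (mem_fixedField_iff _ x).mp hx σ (hHN hσ)
    rwa [IsGalois.fixedField_fixingSubgroup] at hx'
  have hlt : B₁.fixingSubgroup.index < n := by
    rw [hNB₁, ← hn, ← Subgroup.relIndex_mul_index hHN]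
    change N.index < ℓ * N.index
    have hpos : 0 < N.index := Nat.pos_of_ne_zero Subgroup.FiniteIndex.index_ne_zero
    have h2 := hℓ.two_le
    nlinarith
  have reach₁ := ih _ hlt B₁ (le_trans hle hB) rfl
  -- the step `B₁ ⊆ B`, of prime degree `ℓ`, with `e = ℓ`
  haveI : IsScalarTower k B₁ L := isScalarTower_intermediateField' (k := k) B₁
  have hcardN : Nat.card N = ℓ * Nat.card B.fixingSubgroup := by
    have h1 := (B.fixingSubgroup.subgroupOf N).index_mul_card
    rw [Nat.card_congr (Subgroup.subgroupOfEquivOfLe hHN).toEquiv] at h1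
    exact h1.symm
  have hdeg : Module.finrank B₁ (extendScalars hle) = ℓ := by
    have htower := Module.finrank_mul_finrank B₁ (extendScalars hle) L
    have hxL : Module.finrank (extendScalars hle) L = Nat.card B.fixingSubgroup :=
      finrank_eq_card_fixingSubgroup B
    have hB₁L : Module.finrank B₁ L = Nat.card N := by
      rw [hB₁]
      exact finrank_fixedField_eq_card N
    rw [hxL, hB₁L, hcardN] at htower
    exact Nat.eq_of_mul_eq_mul_right Nat.card_pos htower
  have hprime : (Module.finrank B₁ (extendScalars hle)).Prime := hdeg ▸ hℓ
  have step : CMove3 k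
      ⟨B₁, W.comap (algebraMap B₁ L), forall_algebraMap_mem_comap_intermediateField hkW B₁⟩
      ⟨B, W.comap (algebraMap B L), forall_algebraMap_mem_comap_intermediateField hkW B⟩ := by
    have h0 := CMove3.primeUp (k := k) hprime (W.comap (algebraMap (extendScalars hle) L))
      (forall_algebraMap_mem_comap_intermediateField hkW (extendScalars hle))
      (Or.inr (horacle B₁ B hle hB))
    rw [VState.mk_congr (comap_comap_algebraMap (extendScalars hle) W) _
      (forall_algebraMap_mem_comap_intermediateField hkW B₁)] at h0
    exact h0
  exact Relation.ReflTransGen.tail reach₁ step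

end Climb

/-! ### The named residual and the assembled consequences -/

/-- NAMED RESIDUAL — **the layers of `Kʳ/Kⁱ` are totally ramified**: for `L/K` finite Galois,
`W` a valuation ring of `L`, `Kⁱ = L^{G_i}` and `Kʳ = L^{G_r}` (ramification group of `W` in
`Gal(L/Kⁱ) = G_i`), every layer `Kⁱ ⊆ B₁ ⊆ B ⊆ Kʳ` has `e(W ∩ B | W ∩ B₁) = [B : B₁]`
(the assumption "`[L : K] = |WL/VK|`" of Prop. 8.3 (2), which the proof of Thm 7.2, HAL p. 20,
declares "satisfied by (9)" along the tame tower; Zariski–Samuel VI §12 Thm 25 "The groups `Γ̃₀`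
and `G_T/G_V` are isomorphic … Their orders `e₀` and `e′₀` are equal", with multiplicativity of
`e` and `e ≤ degree`). PROVED in the sequel `TameLayers2008`
(`TameLayersTotallyRamified2008_holds`). [cite: CossartPiltant2008, Thm 7.2 proof (HAL p. 20),
§3.2 (8)–(9) (HAL p. 6), Prop 8.3 (HAL p. 23); ZariskiSamuel1960 VI §12 Thm 25] -/
def TameLayersTotallyRamified2008 : Prop :=
  ∀ (K L : Type u) [Field K] [Field L] [Algebra K L] [FiniteDimensional K L] [IsGalois K L]
    (W : ValuationSubring L)
    (B₁ B : IntermediateField (fixedField (inertiaGroup (K := K) W)) L) (h : B₁ ≤ B),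
    B ≤ fixedField (ramificationGroup (K := fixedField (inertiaGroup (K := K) W)) W) →
    ramificationIndex B₁ (W.comap (algebraMap (extendScalars h) L)) =
      Module.finrank B₁ (extendScalars h)

/-- **The tame climb from total ramification** — PROVED: `TameLayersTotallyRamified2008`
implies `TameSegmentClimb2008 k` for every ground field `k` (the abelian climb
`CReach3.climb_of_commutator_mem` over `F := Kⁱ`, with `V := G_r ⊇ [G_i, G_i]`).
[cite: CossartPiltant2008, Thm 7.2 proof, (8) (HAL p. 20)] -/
theorem tameSegmentClimb2008_of_layers (hT : TameLayersTotallyRamified2008.{u}) (k : Type u)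
    [Field k] : TameSegmentClimb2008 k := by
  intro p hp hchar K _ _ L _ _ _ _ _ _ W hkW
  set F : IntermediateField K L := fixedField (inertiaGroup (K := K) W) with hF
  haveI : IsScalarTower k F L := isScalarTower_intermediateField' (k := k) F
  have hGT : F.fixingSubgroup = inertiaGroup (K := K) W := fixingSubgroup_fixedField _
  have hres : ∀ a : L ≃ₐ[F] L, a.restrictScalars K ∈ inertiaGroup (K := K) W := fun a => by
    rw [← hGT, IntermediateField.mem_fixingSubgroup_iff]
    intro x hx
    exact a.commutes ⟨x, hx⟩
  let V : Subgroup (L ≃ₐ[F] L) := ramificationGroup (K := F) W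
  have hcomm : ∀ a b : L ≃ₐ[F] L, a * b * a⁻¹ * b⁻¹ ∈ V := fun a b => by
    have hc := commutator_mem_ramificationGroup W (hres a) (hres b)
    rw [mem_ramificationGroup_iff] at hc
    exact (mem_ramificationGroup_iff W _).mpr hc
  have hir : F ≤ fixedField (ramificationGroup (K := K) W) := fixedField_inertiaGroup_le W
  have hB : extendScalars hir ≤ fixedField V := fun x hx => by
    rw [IntermediateField.mem_fixedField_iff]
    intro σ hσ
    have hσ' : σ.restrictScalars K ∈ ramificationGroup (K := K) W :=
      (mem_ramificationGroup_iff W _).mpr ((mem_ramificationGroup_iff W σ).mp hσ)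
    exact (IntermediateField.mem_fixedField_iff _ x).mp hx (σ.restrictScalars K) hσ'
  exact CReach3.climb_of_commutator_mem V hcomm W hkW (fun B₁ B h hBV => hT K L W B₁ B h hBV)
    (extendScalars hir) hB

variable {k : Type u} [Field k]

/-- **The tower fact from total ramification of the tame layers** — PROVED.
[cite: CossartPiltant2008, Thm 7.2 proof (HAL pp. 20–21)] -/
theorem coarseTowerExists2008_of_layers (hT : TameLayersTotallyRamified2008.{u}) :
    CoarseTowerExists2008 k :=
  coarseTowerExists2008_of_tame (tameSegmentClimb2008_of_layers hT k)

/-- **`GaloisTowerExists2008` from total ramification of the tame layers** — PROVED.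
[cite: CossartPiltant2008, Thm 7.2 proof (HAL pp. 20–21)] -/
theorem galoisTowerExists2008_of_layers (hT : TameLayersTotallyRamified2008.{u}) :
    GaloisTowerExists2008 k :=
  galoisTowerExists2008_of_tame (tameSegmentClimb2008_of_layers hT k)

/-- **Theorem 7.2 from its leaves**: Cor 6.3, Prop 8.3, Prop 9.5 and total ramification of the
tame layers imply `ReductionToArtinSchreier`. [cite: CossartPiltant2008, Thm 7.2 (HAL pp. 19–21)] -/
theorem reductionToArtinSchreier_of_layers (h63 : ClimbToInertiaField.{u})
    (h83 : PrimeDegreeAscent.{u}) (h95 : DescentBelowRamificationField.{u})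
    (hT : TameLayersTotallyRamified2008.{u}) : ReductionToArtinSchreier.{u} :=
  reductionToArtinSchreier_of_tame h63 h83 h95 fun k _ => tameSegmentClimb2008_of_layers hT k

/-- **`LU3DiffFinite` from its leaves**: Prop 5.1, Cor 6.3, Prop 8.3, Prop 9.5, total
ramification of the tame layers and [CP-II]. [cite: CossartPiltant2008, Thm 7.2 + Section 2] -/
theorem lu3DiffFinite_of_layers (p51 : RankReduction.{u}) (h63 : ClimbToInertiaField.{u})
    (h83 : PrimeDegreeAscent.{u}) (h95 : DescentBelowRamificationField.{u})
    (hT : TameLayersTotallyRamified2008.{u}) (cp2 : CossartPiltant2009Main.{u}) :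
    LU3DiffFinite.{u} :=
  lu3DiffFinite_of_tame p51 h63 h83 h95 (fun k _ => tameSegmentClimb2008_of_layers hT k) cp2

end Literature.AlgebraicGeometry.CossartPiltant200819.CP2008
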